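import Mathlib
import Summits.MatrixMultiplication.MatrixMultiplication.Theorems.HiddenToeplitzCornersHiddenCornerLemmaRMixedOneOne
import Summits.MatrixMultiplication.MatrixMultiplication.Theorems.HiddenToeplitzCornersHiddenCornerLemmaRBlockToeplitzSlot

/-!
# Stub `stub_mixedDeepBound` — line `atkinson-lloyd-core-split`, crux `HiddenCornerLemmaR`: the provable cases

Support file for crux item `stmt-MatrixMultiplication-10752`
(`Summit.MatrixMultiplication.MatrixMultiplication.Theses.HiddenToeplitzCorners.HiddenCornerLemmaR`),
line `atkinson-lloyd-core-split`, registered stub `stub_mixedDeepBound` (mixed compression class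
`∇T a b = G₀ (H₁ a b)ᵀ + (G₁ a b) H₀ᵀ`, `p` constant left generators, `q ≥ 1` constant right
generators, hidden corner `T(X) E = F X` with rank-`r` frames, a nonsingular member, and the DEEP
hypothesis "every target column vanishes above every cut above which `G₀` vanishes"; conclusion
`r ≤ 2(p+q)`).  Notation: `Z` = lower shift (written out as `Matrix.of …`), `∇M = M − Z M Zᵀ`.

The general statement is open.  Its first open cases are `(p,q) = (2,1)` — which contains the pure
left-constant class with `p = 2` and target `r ≤ 6` (take `G₁ ≡ 0`), i.e. the open core of
`stub_leftConstBound` — and `(p,q) = (1,2)`, the first genuinely mixed one.  This file proves: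

§2 `hclR_mixed_row0_cuts_bound` — in the mixed class with `G₀` supported on row `0` and `H₀`
   supported on the rows of a finite set `C` (e.g. toric right generators), every `∇(T a b)` is
   supported on row `0 ∪` columns `C`, so every `T a b` is Toeplitz inside the column blocks cut
   out by `C` (`blk j = #{c ∈ C : 0 < c ≤ j}`), and the block-Toeplitz slot lemma
   `hclR_blockToeplitz_slot` (`HiddenCornerLemmaRBlockToeplitzSlot`) with `#C + 3` slots kills every
   target column: `r ≤ #C + 2` from `rank F = r` and the corner identity alone (any `p`, `q`, no
   nonsingularity, no hypothesis on `E`).  For `C ⊆ {0}` compare `hclR_mixed_row0_bound` (`r ≤ 2`).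
§3 the stub with its EXACT binder list and hypotheses plus explicit extra hypotheses:
   * `mixedDeepBound_p_zero` — `p = 0`: the deep hypothesis at the cut `c := N` has a vacuous
     premise (`G₀` has no columns), so `F = 0` and `r = rank F = 0`;
   * `mixedDeepBound_le_one_one` — `p ≤ 1 → q ≤ 1`: `(p,q) = (1,1)` is the landed mixed `(1,1)`
     law `hclR_mixed_one_one_stub` (`r ≤ 2p + q = 3`; any generators, no deep hypothesis needed);
   * `mixedDeepBound_row0_toric` — `G₀` supported on row `0` (so `p ≤ 1` by `rank G₀ = p`) and
     `H₀` supported on at most `q` rows: `r ≤ q + 2 ≤ 2(p+q)` by §2 (`p = 0` by the first case).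
     This is the `γ = 0`, toric-`H₀` instance of the open case `(1,q)`, `q ≥ 2`, within one of the
     conjectured sharp value `q + 1`.

Not covered (open): `(1,q)` with a non-toric `H₀` or with `G₀` of positive valuation `γ` (the deep
branch proper), and every `p ≥ 2`.  Evidence recorded with the lead: exact mod-`P` computations of
the common single-slot target space show that for `γ = 0` the class `ℂ[Zᵀ] + Σ_{l ≤ q} ℂ[Z]·U(w_l)`
never supports `q + 2` slots (`q = 1`: `r = 3`, all `w`, `N ≤ 10`; `q = 2`: `r = 4`, all
`w₁, w₂`, `N ≤ 9`; zero exceptions), i.e. a `(q+2)`-slot lemma for GENERAL right generators is the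
expected engine of the `(1,q)` law at `γ = 0`; for `γ > 0` the single-row capacity is unbounded on
singular configurations and the nonsingular member must be consumed as in the `(1,1)` proof.
-/

set_option linter.dupNamespace false

/-! ## §2  Cut columns: the toric mixed law at `γ = 0` -/

namespace Summit.MatrixMultiplication.MatrixMultiplication.Theorems

open Matrix BigOperators Finset

/-- Entries of `Z * M * Zᵀ` away from row `0` and column `0`: `(Z M Zᵀ) i j = M (i-1) (j-1)`. -/
private theorem blk_shift_conj_apply {N : ℕ} (M : Matrix (Fin N) (Fin N) ℂ) (i j : Fin N)
    (hi : 0 < (i : ℕ)) (hj : 0 < (j : ℕ)) :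
    ((Matrix.of fun i j : Fin N => if (i : ℕ) = (j : ℕ) + 1 then (1 : ℂ) else 0) * M *
      (Matrix.of fun i j : Fin N => if (i : ℕ) = (j : ℕ) + 1 then (1 : ℂ) else 0)ᵀ) i j =
      M ⟨(i : ℕ) - 1, by omega⟩ ⟨(j : ℕ) - 1, by omega⟩ := by
  -- adapted from `toep3_shift_conj_apply` (HiddenCornerLemmaRMixedToeplitz)
  rw [Matrix.mul_apply]
  simp only [Matrix.transpose_apply, Matrix.mul_apply, Matrix.of_apply]
  rw [Finset.sum_eq_single ⟨(j : ℕ) - 1, by omega⟩]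
  · rw [if_pos (by simp; omega), mul_one]
    rw [Finset.sum_eq_single ⟨(i : ℕ) - 1, by omega⟩]
    · rw [if_pos (by simp; omega), one_mul]
    · intro a _ ha
      rw [if_neg, zero_mul]
      intro h'
      apply ha
      ext
      simp only at h' ⊢
      omega
    · simp
  · intro b _ hb
    rw [if_neg, mul_zero]
    intro h'
    apply hb
    ext
    simp only at h' ⊢
    omega
  · simp

/-- **Cut columns.**  If the Stein displacement `M - Z M Zᵀ` vanishes away from row `0` and the
columns in a finite set `C`, then `M` is Toeplitz inside every column block cut out by `C`:
with the monotone label `blk j = #{c ∈ C : 0 < c ≤ j}`, `M i j = M i' j'` whenever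
`blk j = blk j'` and `i + j' = i' + j`. -/
private theorem blk_toeplitz_of_disp {N : ℕ} (M D : Matrix (Fin N) (Fin N) ℂ) (C : Finset (Fin N))
    (h : M - (Matrix.of fun i j : Fin N => if (i : ℕ) = (j : ℕ) + 1 then (1 : ℂ) else 0) * M *
      (Matrix.of fun i j : Fin N => if (i : ℕ) = (j : ℕ) + 1 then (1 : ℂ) else 0)ᵀ = D)
    (hD : ∀ i j : Fin N, (i : ℕ) ≠ 0 → j ∉ C → D i j = 0) :
    ∀ i j i' j' : Fin N,
      (C.filter fun c : Fin N => 0 < (c : ℕ) ∧ c ≤ j).card = (C.filter fun c : Fin N => 0 < (c : ℕ) ∧ c ≤ j').card →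
      (i : ℕ) + j' = i' + j → M i j = M i' j' := by
  set bl : Fin N → ℕ := fun j => (C.filter fun c : Fin N => 0 < (c : ℕ) ∧ c ≤ j).card with hbl
  have hmono : ∀ j j' : Fin N, j ≤ j' → bl j ≤ bl j' := by
    intro j j' hjj
    apply Finset.card_le_card
    intro c hc
    simp only [Finset.mem_filter] at hc ⊢
    exact ⟨hc.1, hc.2.1, hc.2.2.trans hjj⟩
  have hjump : ∀ j j' : Fin N, (j' : ℕ) + 1 = j → j ∈ C → bl j' < bl j := by
    intro j j' hj hjC
    apply Finset.card_lt_card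
    refine (Finset.ssubset_iff_of_subset ?_).mpr ⟨j, ?_, ?_⟩
    · intro c hc
      simp only [Finset.mem_filter] at hc ⊢
      refine ⟨hc.1, hc.2.1, ?_⟩
      have := hc.2.2
      rw [Fin.le_def] at this ⊢
      omega
    · simp only [Finset.mem_filter]
      exact ⟨hjC, by omega, le_rfl⟩
    · simp only [Finset.mem_filter, not_and, not_le]
      intro _ _
      rw [Fin.lt_def]; omega
  have hstep : ∀ i j i' j' : Fin N, (i' : ℕ) + 1 = i → (j' : ℕ) + 1 = j → j ∉ C →
      M i j = M i' j' := by
    intro i j i' j' hi hj hjC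
    have e := congr_fun (congr_fun h i) j
    rw [Matrix.sub_apply, blk_shift_conj_apply M i j (by omega) (by omega), hD i j (by omega) hjC] at e
    have e1 : (⟨(i : ℕ) - 1, by omega⟩ : Fin N) = i' := Fin.ext (by simp only; omega)
    have e2 : (⟨(j : ℕ) - 1, by omega⟩ : Fin N) = j' := Fin.ext (by simp only; omega)
    rw [e1, e2] at e
    exact sub_eq_zero.mp e
  have hcanon : ∀ d : ℕ, ∀ i j i₀ j₀ : Fin N, (i : ℕ) = i₀ + d → (j : ℕ) = j₀ + d →
      bl j = bl j₀ → M i j = M i₀ j₀ := by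
    intro d
    induction d with
    | zero =>
      intro i j i₀ j₀ hi hj _
      have e1 : i = i₀ := Fin.ext (by omega)
      have e2 : j = j₀ := Fin.ext (by omega)
      rw [e1, e2]
    | succ d ih =>
      intro i j i₀ j₀ hi hj hb
      obtain ⟨i', hi'⟩ : ∃ i' : Fin N, (i' : ℕ) + 1 = i := ⟨⟨(i : ℕ) - 1, by omega⟩, by simp only; omega⟩
      obtain ⟨j', hj'⟩ : ∃ j' : Fin N, (j' : ℕ) + 1 = j := ⟨⟨(j : ℕ) - 1, by omega⟩, by simp only; omega⟩
      have h1 : bl j₀ ≤ bl j' := hmono j₀ j' (by rw [Fin.le_def]; omega)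
      have h2 : bl j' ≤ bl j := hmono j' j (by rw [Fin.le_def]; omega)
      have hjC : j ∉ C := by
        intro hjC
        have := hjump j j' hj' hjC
        omega
      rw [hstep i j i' j' hi' hj' hjC]
      exact ih i' j' i₀ j₀ (by omega) (by omega) (by omega)
  intro i j i' j' hb hsum
  rcases le_total j j' with hjj | hjj
  · have hd : (j : ℕ) ≤ j' := hjj
    exact (hcanon ((j' : ℕ) - j) i' j' i j (by omega) (by omega) hb.symm).symm
  · have hd : (j' : ℕ) ≤ j := hjj
    exact hcanon ((j : ℕ) - j') i j i' j' (by omega) (by omega) hb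

/-- Corner per coefficient: testing `T(X) E = F X` at `X = single a b 1` gives
`T a b *ᵥ (col c of E) = [b = c] • (col a of F)`. -/
private theorem blk_corner_col {r N : ℕ} (T : Fin r → Fin r → Matrix (Fin N) (Fin N) ℂ)
    (E F : Matrix (Fin N) (Fin r) ℂ)
    (hcorner : ∀ X : Matrix (Fin r) (Fin r) ℂ, (∑ a : Fin r, ∑ b : Fin r, X a b • T a b) * E = F * X)
    (a b c : Fin r) :
    T a b *ᵥ (fun i => E i c) = if b = c then (fun i => F i a) else 0 := by
  -- adapted from `hclR_gconst_d_one` (column extraction of the corner identity)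
  have h1 := hcorner (Matrix.single a b 1)
  have hsum : (∑ a' : Fin r, ∑ b' : Fin r, (Matrix.single a b (1 : ℂ)) a' b' • T a' b') = T a b := by
    rw [Finset.sum_eq_single a]
    · rw [Finset.sum_eq_single b]
      · simp
      · intro b' _ hb'; simp [hb'.symm]
      · simp
    · intro a' _ ha'
      apply Finset.sum_eq_zero; intro b' _
      simp [ha'.symm]
    · simp
  rw [hsum] at h1
  ext i
  have h2 := congr_fun (congr_fun h1 i) c
  rw [Matrix.mul_apply] at h2
  simp only [Matrix.mulVec, dotProduct]
  rw [h2, Matrix.mul_apply]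
  by_cases hbc : b = c
  · subst hbc
    rw [if_pos rfl, Finset.sum_eq_single a]
    · simp
    · intro j _ hj; simp [hj.symm]
    · simp
  · rw [if_neg hbc]
    simp only [Pi.zero_apply]
    apply Finset.sum_eq_zero; intro j _
    simp only [Matrix.single_apply, mul_ite, mul_one, mul_zero, ite_eq_right_iff, and_imp]
    intro _ hbc'; exact absurd hbc' hbc

/-- **Mixed law with the left generators on row `0` and the right generators on `#C` cut rows.**
In the mixed compression class `∇(T a b) = G₀ (H₁ a b)ᵀ + (G₁ a b) H₀ᵀ` suppose the constant left
factor `G₀` is supported on row `0` and the constant right factor `H₀` on the rows of a finite set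
`C` (e.g. toric right generators `e_{ω_1}, …, e_{ω_q}`).  Then every `∇(T a b)` is supported on
row `0 ∪` columns `C`, every coefficient matrix is Toeplitz inside the column blocks cut out by
`C` (`blk_toeplitz_of_disp`), and the block-Toeplitz slot lemma with `#C + 3` slots kills every
target column: a hidden corner with `rank F = r` has `r ≤ #C + 2` (no nonsingularity, no
hypothesis on `E`, any `p`, `q`).  For `C = {0}` this is `hclR_mixed_row0_bound` up to one. -/
theorem hclR_mixed_row0_cuts_bound (r N p q : ℕ) (T : Fin r → Fin r → Matrix (Fin N) (Fin N) ℂ)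
    (E F : Matrix (Fin N) (Fin r) ℂ) (G₀ : Matrix (Fin N) (Fin p) ℂ) (H₀ : Matrix (Fin N) (Fin q) ℂ)
    (H₁ : Fin r → Fin r → Matrix (Fin N) (Fin p) ℂ) (G₁ : Fin r → Fin r → Matrix (Fin N) (Fin q) ℂ)
    (C : Finset (Fin N))
    (hG₀ : ∀ (i : Fin N) (k : Fin p), (i : ℕ) ≠ 0 → G₀ i k = 0)
    (hH₀ : ∀ (j : Fin N) (l : Fin q), j ∉ C → H₀ j l = 0)
    (hF : F.rank = r)
    (hcorner : ∀ X : Matrix (Fin r) (Fin r) ℂ, (∑ a : Fin r, ∑ b : Fin r, X a b • T a b) * E = F * X)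
    (hdisp : ∀ a b, T a b - (Matrix.of fun i j : Fin N => if (i : ℕ) = (j : ℕ) + 1 then (1 : ℂ) else 0) *
        T a b * (Matrix.of fun i j : Fin N => if (i : ℕ) = (j : ℕ) + 1 then (1 : ℂ) else 0)ᵀ
        = G₀ * (H₁ a b)ᵀ + G₁ a b * H₀ᵀ) :
    r ≤ C.card + 2 := by
  by_contra hr
  push Not at hr
  -- block labels
  set B := C.card + 1 with hB
  let blk : Fin N → Fin B := fun j =>
    ⟨(C.filter fun c : Fin N => 0 < (c : ℕ) ∧ c ≤ j).card, Nat.lt_succ_of_le (Finset.card_filter_le _ _)⟩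
  have hmono : ∀ j j' : Fin N, j ≤ j' → blk j ≤ blk j' := by
    intro j j' hjj
    show (C.filter fun c : Fin N => 0 < (c : ℕ) ∧ c ≤ j).card ≤ (C.filter fun c : Fin N => 0 < (c : ℕ) ∧ c ≤ j').card
    apply Finset.card_le_card
    intro c hc
    simp only [Finset.mem_filter] at hc ⊢
    exact ⟨hc.1, hc.2.1, hc.2.2.trans hjj⟩
  have htoep : ∀ a b, ∀ i j i' j' : Fin N, blk j = blk j' → (i : ℕ) + j' = i' + j →
      T a b i j = T a b i' j' := by
    intro a b i j i' j' hb hsum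
    refine blk_toeplitz_of_disp (T a b) _ C (hdisp a b) ?_ i j i' j' (congrArg Fin.val hb) hsum
    intro i₁ j₁ hi hj
    rw [Matrix.add_apply, Matrix.mul_apply, Matrix.mul_apply]
    rw [Finset.sum_eq_zero, Finset.sum_eq_zero, add_zero]
    · intro k _; rw [Matrix.transpose_apply, hH₀ j₁ k hj, mul_zero]
    · intro k _; rw [hG₀ i₁ k hi, zero_mul]
  -- `B + 2` slots `0, …, B + 1 : Fin r`
  let β : Fin (B + 2) → Fin r := fun s => ⟨(s : ℕ), by omega⟩
  have hβ : ∀ s t : Fin (B + 2), β s = β t → s = t := by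
    intro s t h
    have := congrArg Fin.val h
    exact Fin.ext this
  have hFcol : ∀ a : Fin r, (fun i => F i a) = 0 := by
    intro a
    refine hclR_blockToeplitz_slot N B blk hmono (fun s => T a (β s)) (fun s => htoep a (β s))
      (fun s i => E i (β s)) (fun i => F i a) ?_
    intro s t
    show T a (β s) *ᵥ (fun i => E i (β t)) = if s = t then (fun i => F i a) else 0
    rw [blk_corner_col T E F hcorner a (β s) (β t)]
    by_cases hst : s = t
    · subst hst; rw [if_pos rfl, if_pos rfl]
    · rw [if_neg (fun h => hst (hβ s t h)), if_neg hst]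
  have hF0 : F = 0 := by
    ext i a
    exact congr_fun (hFcol a) i
  rw [hF0, Matrix.rank_zero] at hF
  omega


end Summit.MatrixMultiplication.MatrixMultiplication.Theorems

/-! ## §3  The registered stub: provable cases -/

namespace Summit.MatrixMultiplication.MatrixMultiplication.Cruxes.HiddenCornerLemmaR.AtkinsonLloydCoreSplit

open Matrix
open Summit.MatrixMultiplication.MatrixMultiplication.Theorems (hclR_mixed_one_one_stub
  hclR_mixed_row0_cuts_bound)

/-- **`stub_mixedDeepBound` for `p = 0`.**  With no constant left generator the deep hypothesis
at the cut `c := N` applies (its premise quantifies over `Fin 0`), so every entry of `F` vanishes,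
`F = 0`, and `r = rank F = 0 ≤ 2(p+q)`. -/
theorem mixedDeepBound_p_zero :
    ∀ (r N p q : ℕ) (T : Fin r → Fin r → Matrix (Fin N) (Fin N) ℂ) (E F : Matrix (Fin N) (Fin r) ℂ)
    (G₀ : Matrix (Fin N) (Fin p) ℂ) (H₀ : Matrix (Fin N) (Fin q) ℂ)
    (H₁ : Fin r → Fin r → Matrix (Fin N) (Fin p) ℂ) (G₁ : Fin r → Fin r → Matrix (Fin N) (Fin q) ℂ),
    p = 0 →
    0 < q → E.rank = r → F.rank = r → G₀.rank = p → H₀.rank = q →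
    (∀ X : Matrix (Fin r) (Fin r) ℂ, (∑ a : Fin r, ∑ b : Fin r, X a b • T a b) * E = F * X) →
    (∀ a b, T a b - (Matrix.of fun i j : Fin N => if (i : ℕ) = (j : ℕ) + 1 then (1 : ℂ) else 0) * T a b * (Matrix.of fun i j : Fin N => if (i : ℕ) = (j : ℕ) + 1 then (1 : ℂ) else 0)ᵀ = G₀ * (H₁ a b)ᵀ + G₁ a b * H₀ᵀ) →
    (∃ X₀ : Matrix (Fin r) (Fin r) ℂ, (∑ a : Fin r, ∑ b : Fin r, X₀ a b • T a b).det ≠ 0) →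
    (∀ c : ℕ, (∀ i : Fin N, (i : ℕ) < c → ∀ k : Fin p, G₀ i k = 0) →
      ∀ (a : Fin r) (i : Fin N), (i : ℕ) < c → F i a = 0) →
    r ≤ 2 * (p + q) := by
  intro r N p q T E F G₀ H₀ H₁ G₁ hp _hq _hE hF _hG₀ _hH₀ _hcorner _hdisp _hns hdeep
  subst hp
  have hF0 : F = 0 := by
    ext i a
    exact hdeep N (fun _ _ k => Fin.elim0 k) a i i.is_lt
  rw [hF0, Matrix.rank_zero] at hF
  omega

/-- **`stub_mixedDeepBound` for `p ≤ 1`, `q ≤ 1`.**  The case `p = 0` is `mixedDeepBound_p_zero`;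
the case `(p,q) = (1,1)` is the landed mixed `(1,1)` law `hclR_mixed_one_one_stub`
(`r ≤ 2p + q = 3`), which needs neither the deep hypothesis nor the rank hypotheses on `G₀`, `H₀`. -/
theorem mixedDeepBound_le_one_one :
    ∀ (r N p q : ℕ) (T : Fin r → Fin r → Matrix (Fin N) (Fin N) ℂ) (E F : Matrix (Fin N) (Fin r) ℂ)
    (G₀ : Matrix (Fin N) (Fin p) ℂ) (H₀ : Matrix (Fin N) (Fin q) ℂ)
    (H₁ : Fin r → Fin r → Matrix (Fin N) (Fin p) ℂ) (G₁ : Fin r → Fin r → Matrix (Fin N) (Fin q) ℂ),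
    p ≤ 1 → q ≤ 1 →
    0 < q → E.rank = r → F.rank = r → G₀.rank = p → H₀.rank = q →
    (∀ X : Matrix (Fin r) (Fin r) ℂ, (∑ a : Fin r, ∑ b : Fin r, X a b • T a b) * E = F * X) →
    (∀ a b, T a b - (Matrix.of fun i j : Fin N => if (i : ℕ) = (j : ℕ) + 1 then (1 : ℂ) else 0) * T a b * (Matrix.of fun i j : Fin N => if (i : ℕ) = (j : ℕ) + 1 then (1 : ℂ) else 0)ᵀ = G₀ * (H₁ a b)ᵀ + G₁ a b * H₀ᵀ) →
    (∃ X₀ : Matrix (Fin r) (Fin r) ℂ, (∑ a : Fin r, ∑ b : Fin r, X₀ a b • T a b).det ≠ 0) →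
    (∀ c : ℕ, (∀ i : Fin N, (i : ℕ) < c → ∀ k : Fin p, G₀ i k = 0) →
      ∀ (a : Fin r) (i : Fin N), (i : ℕ) < c → F i a = 0) →
    r ≤ 2 * (p + q) := by
  intro r N p q T E F G₀ H₀ H₁ G₁ hp hq hq0 hE hF hG₀ hH₀ hcorner hdisp hns hdeep
  rcases Nat.eq_zero_or_pos p with hp0 | hp0
  · exact mixedDeepBound_p_zero r N p q T E F G₀ H₀ H₁ G₁ hp0 hq0 hE hF hG₀ hH₀ hcorner hdisp hns hdeep
  · have hp1 : p = 1 := by omega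
    have hq1 : q = 1 := by omega
    have hle := hclR_mixed_one_one_stub r N p q T E F G₀ H₀ H₁ G₁ hp1 hq1 hp0 hq0 hE hF hcorner hdisp hns
    omega

/-- **`stub_mixedDeepBound` with `G₀` on row `0` and toric-support `H₀`.**  If the constant left
factor `G₀` is supported on row `0` (so `γ = 0`; `rank G₀ = p` then forces `p ≤ 1`) and the
constant right factor `H₀` is supported on at most `q` rows (e.g. its columns are unit vectors
`e_{ω_1}, …, e_{ω_q}`), then `r ≤ q + 2 ≤ 2(p+q)`: the case `p = 0` is `mixedDeepBound_p_zero`,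
and for `p ≥ 1` the toric mixed law `hclR_mixed_row0_cuts_bound` (block-Toeplitz slot lemma)
gives `r ≤ q + 2` — using only `rank F = r` and the corner identity. -/
theorem mixedDeepBound_row0_toric :
    ∀ (r N p q : ℕ) (T : Fin r → Fin r → Matrix (Fin N) (Fin N) ℂ) (E F : Matrix (Fin N) (Fin r) ℂ)
    (G₀ : Matrix (Fin N) (Fin p) ℂ) (H₀ : Matrix (Fin N) (Fin q) ℂ)
    (H₁ : Fin r → Fin r → Matrix (Fin N) (Fin p) ℂ) (G₁ : Fin r → Fin r → Matrix (Fin N) (Fin q) ℂ),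
    (∀ (i : Fin N) (k : Fin p), (i : ℕ) ≠ 0 → G₀ i k = 0) →
    (∃ C : Finset (Fin N), C.card ≤ q ∧ ∀ (j : Fin N) (l : Fin q), j ∉ C → H₀ j l = 0) →
    0 < q → E.rank = r → F.rank = r → G₀.rank = p → H₀.rank = q →
    (∀ X : Matrix (Fin r) (Fin r) ℂ, (∑ a : Fin r, ∑ b : Fin r, X a b • T a b) * E = F * X) →
    (∀ a b, T a b - (Matrix.of fun i j : Fin N => if (i : ℕ) = (j : ℕ) + 1 then (1 : ℂ) else 0) * T a b * (Matrix.of fun i j : Fin N => if (i : ℕ) = (j : ℕ) + 1 then (1 : ℂ) else 0)ᵀ = G₀ * (H₁ a b)ᵀ + G₁ a b * H₀ᵀ) →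
    (∃ X₀ : Matrix (Fin r) (Fin r) ℂ, (∑ a : Fin r, ∑ b : Fin r, X₀ a b • T a b).det ≠ 0) →
    (∀ c : ℕ, (∀ i : Fin N, (i : ℕ) < c → ∀ k : Fin p, G₀ i k = 0) →
      ∀ (a : Fin r) (i : Fin N), (i : ℕ) < c → F i a = 0) →
    r ≤ 2 * (p + q) := by
  intro r N p q T E F G₀ H₀ H₁ G₁ hG₀ hC hq0 hE hF hG₀r hH₀ hcorner hdisp hns hdeep
  rcases Nat.eq_zero_or_pos p with hp0 | hp0
  · exact mixedDeepBound_p_zero r N p q T E F G₀ H₀ H₁ G₁ hp0 hq0 hE hF hG₀r hH₀ hcorner hdisp hns hdeep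
  · obtain ⟨C, hCq, hH₀C⟩ := hC
    have hle := hclR_mixed_row0_cuts_bound r N p q T E F G₀ H₀ H₁ G₁ C hG₀ hH₀C hF hcorner hdisp
    omega

end Summit.MatrixMultiplication.MatrixMultiplication.Cruxes.HiddenCornerLemmaR.AtkinsonLloydCoreSplit
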